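import Summits.CriticalPhenomena.PercolationContinuityZ3.Theorems.PercNearOneGluingNoHeavyLowerTailStarSetWordDesignations
import Summits.CriticalPhenomena.PercolationContinuityZ3.Theorems.PercNearOneGluingNoHeavyLowerTailStarSetWordCaps
import Summits.CriticalPhenomena.PercolationContinuityZ3.Theorems.PercNearOneGluingNoHeavyLowerTailStarSetFamilyLoad
import Summits.CriticalPhenomena.PercolationContinuityZ3.Theorems.PercNearOneGluingNoHeavyLowerTailStarSetLoadTriangle
import Summits.CriticalPhenomena.PercolationContinuityZ3.Theorems.PercNearOneGluingNoHeavyLowerTailStarSetOmegaCliques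
import HarnessLib

/-!
# `NoHeavyLowerTail` (stmt-CriticalPhenomena-4575) — rider families of the residual bound (U1-PROOF.md §6; blueprint §G4)

Support file (prover `prim-gen-swap` gen 15; `--supports stmt-CriticalPhenomena-4575`).  No definitions, no named facts, no sorries.

A residual configuration `S` of a `𝓤_dom` pair `(X, J)` (hub `X = {e, ē}` a chord avoiding `r`, first open forest class `J = {e, s}`
avoiding `r`) with a NON-INERT rider `ρ` (a class of `S ∖ {X, J}` avoiding `r`) requests the third-order word `{X, J, ρ}` of its least
such rider; the configurations with the same `(X, J, ρ)` aggregate to `≤ θ_Xθ_Jθ_ρ` (L2.2).  Two kinds are treated here: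
* F-riders at `e` (`ρ = {e, s'} ∈ F`): designations `(X→ē, J→s, ρ→e)`, `(X→e, J→s, ρ→s')`, capacity `≥ 32 θθθ`
  (`riderF_word_cap_ge`); class-sets of STAR1 shape (one chord, two forest classes, common port);
* riders at the far end `ē` (`ρ = {ē, m}`, forest class or chord, possible only when `e` is hot too): the path word with the balanced
  pair `(X→e, J→s, ρ→ē)`, `(X→ē, J→e, ρ→m)`, capacity `≥ 128 θθθ` (`triangle_word_cap_ge`); class-sets of regular-triple shape.
At most `6` claimant keys `(hub, partner)` occur per class-set (ordered pairs of distinct elements of a 3-set), so the families are paid by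
`6/32` resp. `6/128` of the capacity of their class-sets.

* `StarSet.rider_keys_card_le_six` — keys per three-element class-set;
* `StarSet.riderF_triple_le_cap`, `StarSet.familyRiderF_bound` — `32 θ_Xθ_Jθ_ρ ≤ C_T`, family `≤ (6/32) Σ C_T`;
* `StarSet.riderFar_triple_le_cap`, `StarSet.familyRiderFar_bound` — `128 θ_Xθ_Jθ_ρ ≤ C_T`, family `≤ (6/128) Σ C_T`.
-/

namespace Summit.CriticalPhenomena.PercolationContinuityZ3.Theorems

open Finset
open scoped BigOperators Classical

namespace StarSet

variable {ι V : Type*} [Fintype ι] [LinearOrder ι] [DecidableEq V]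

omit [Fintype ι] [DecidableEq V] in
/-- **At most six claimant keys per three-element class-set**: keys are ordered pairs of distinct elements of the class-set. -/
theorem rider_keys_card_le_six (U : Finset (Finset ι × ι)) (res : Finset ι × ι → Finset ι) (key : Finset ι × ι → ι × ι)
    (w : Finset ι) (hw : w.card = 3)
    (hkey : ∀ u ∈ U, res u = w → (key u).1 ∈ w ∧ (key u).2 ∈ w ∧ (key u).1 ≠ (key u).2) :
    ((U.filter (fun u => res u = w)).image key).card ≤ 6 := by
  have hsub : (U.filter (fun u => res u = w)).image key ⊆ w.offDiag := by
    intro k hk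
    obtain ⟨u, hu, rfl⟩ := mem_image.1 hk
    obtain ⟨huU, huw⟩ := mem_filter.1 hu
    obtain ⟨h1, h2, h3⟩ := hkey u huU huw
    exact mem_offDiag.2 ⟨h1, h2, h3⟩
  refine (card_le_card hsub).trans ?_
  rw [offDiag_card, hw]

/-- **The F-rider word: `32 θ_Xθ_Jθ_ρ ≤ C_T`** for `T = {X, J, ρ}`, `X = {e, ē}`, `J = {e, s}`, `ρ = {e, s'}` (`ē, s, s'` pairwise
distinct; all ports `≠ r`). -/
theorem riderF_triple_le_cap (P P' : ι → V) (r : V)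
    (θ : ι → ℝ) (hθ0 : ∀ X, 0 ≤ θ X) (O : ι → V → ℝ) (hO0 : ∀ X d, 0 ≤ O X d) (Φ : ι → ℝ)
    (hO1 : ∀ X d, (P X = d ∨ P' X = d) → θ X ≤ (1 - θ X) * O X d)
    (hO2 : ∀ X, Φ X ^ 2 ≤ O X (P X) * O X (P' X)) (hΦ4 : ∀ X, 4 * θ X ≤ Φ X)
    {X J ρ : ι} (hXJ : X ≠ J) (hXρ : X ≠ ρ) (hJρ : J ≠ ρ) {e ē s s' : V}
    (heX : P X = e ∨ P' X = e) (hēX : P X = ē ∨ P' X = ē) (hsJ : P J = s ∨ P' J = s)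
    (heρ : P ρ = e ∨ P' ρ = e) (hs'ρ : P ρ = s' ∨ P' ρ = s')
    (heē : e ≠ ē) (hes : e ≠ s) (hes' : e ≠ s') (hēs : ē ≠ s) (hss' : s ≠ s')
    (her : e ≠ r) (hēr : ē ≠ r) (hsr : s ≠ r) (hs'r : s' ≠ r) :
    32 * (θ X * θ J * θ ρ) ≤
      ∑ δ ∈ (univ : Finset (ι → Bool)).filter (fun δ => (∀ K ∉ ({X, J, ρ} : Finset ι), δ K = false) ∧
          3 ≤ (({X, J, ρ} : Finset ι).image fun K => if δ K then P K else P' K).card ∧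
          r ∉ ({X, J, ρ} : Finset ι).image fun K => if δ K then P K else P' K),
        ∏ K ∈ ({X, J, ρ} : Finset ι), O K (if δ K then P K else P' K) := by
  have hOX : Φ X ^ 2 ≤ O X ē * O X e := odds_pair_of_ports P P' O Φ (sym2_eq_of_mem_of_mem heē.symm hēX heX) (hO2 X)
  have hOρ : Φ ρ ^ 2 ≤ O ρ e * O ρ s' := odds_pair_of_ports P P' O Φ (sym2_eq_of_mem_of_mem hes' heρ hs'ρ) (hO2 ρ)
  have h32 := riderF_word_cap_ge (θ X) (θ ρ) (θ J) (Φ X) (Φ ρ) (O X ē) (O X e) (O ρ e) (O ρ s') (O J s)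
    (hθ0 X) (hθ0 ρ) (hθ0 J) (hΦ4 X) (hΦ4 ρ) (hO0 _ _) (hO0 _ _) (hO0 _ _) (hO0 _ _) (hO0 _ _) (hO1 J s hsJ) hOX hOρ
  have hw := two_words_le_cap P P' r O hO0 hXJ hXρ hJρ hēX hsJ heρ hēs heē.symm hes.symm hēr hsr her
    heX hsJ hs'ρ hes hes' hss' her hsr hs'r (Or.inl heē.symm)
  have : O X ē * O ρ e * O J s + O X e * O ρ s' * O J s = O X ē * O J s * O ρ e + O X e * O J s * O ρ s' := by ring
  nlinarith [hθ0 X, hθ0 J, hθ0 ρ]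

/-- **The far-rider word: `128 θ_Xθ_Jθ_ρ ≤ C_T`** for `T = {X, J, ρ}`, `X = {e, ē}`, `J = {e, s}`, `ρ = {ē, m}` (`m ≠ e`; all ports
`≠ r`): the balanced pair `(X→e, J→s, ρ→ē)`, `(X→ē, J→e, ρ→m)`. -/
theorem riderFar_triple_le_cap (P P' : ι → V) (r : V)
    (θ : ι → ℝ) (hθ0 : ∀ X, 0 ≤ θ X) (O : ι → V → ℝ) (hO0 : ∀ X d, 0 ≤ O X d) (Φ : ι → ℝ)
    (hO2 : ∀ X, Φ X ^ 2 ≤ O X (P X) * O X (P' X)) (hΦ4 : ∀ X, 4 * θ X ≤ Φ X)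
    {X J ρ : ι} (hXJ : X ≠ J) (hXρ : X ≠ ρ) (hJρ : J ≠ ρ) {e ē s m : V}
    (heX : P X = e ∨ P' X = e) (hēX : P X = ē ∨ P' X = ē) (heJ : P J = e ∨ P' J = e) (hsJ : P J = s ∨ P' J = s)
    (hēρ : P ρ = ē ∨ P' ρ = ē) (hmρ : P ρ = m ∨ P' ρ = m)
    (heē : e ≠ ē) (hes : e ≠ s) (hem : e ≠ m) (hēs : ē ≠ s) (hēm : ē ≠ m)
    (her : e ≠ r) (hēr : ē ≠ r) (hsr : s ≠ r) (hmr : m ≠ r) :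
    128 * (θ X * θ J * θ ρ) ≤
      ∑ δ ∈ (univ : Finset (ι → Bool)).filter (fun δ => (∀ K ∉ ({X, J, ρ} : Finset ι), δ K = false) ∧
          3 ≤ (({X, J, ρ} : Finset ι).image fun K => if δ K then P K else P' K).card ∧
          r ∉ ({X, J, ρ} : Finset ι).image fun K => if δ K then P K else P' K),
        ∏ K ∈ ({X, J, ρ} : Finset ι), O K (if δ K then P K else P' K) := by
  have hOX : Φ X ^ 2 ≤ O X e * O X ē := odds_pair_of_ports P P' O Φ (sym2_eq_of_mem_of_mem heē heX hēX) (hO2 X)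
  have hOJ : Φ J ^ 2 ≤ O J s * O J e := odds_pair_of_ports P P' O Φ (sym2_eq_of_mem_of_mem hes.symm hsJ heJ) (hO2 J)
  have hOρ : Φ ρ ^ 2 ≤ O ρ ē * O ρ m := odds_pair_of_ports P P' O Φ (sym2_eq_of_mem_of_mem hēm hēρ hmρ) (hO2 ρ)
  have h128 := triangle_word_cap_ge (θ X) (θ J) (θ ρ) (Φ X) (Φ J) (Φ ρ) (O X e) (O X ē) (O J s) (O J e) (O ρ ē) (O ρ m)
    (hθ0 X) (hθ0 J) (hθ0 ρ) (hΦ4 X) (hΦ4 J) (hΦ4 ρ) (hO0 _ _) (hO0 _ _) (hO0 _ _) (hO0 _ _) (hO0 _ _) (hO0 _ _) hOX hOJ hOρ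
  have hw := two_words_le_cap P P' r O hO0 hXJ hXρ hJρ heX hsJ hēρ hes heē hēs.symm her hsr hēr
    hēX heJ hmρ heē.symm hēm hem hēr her hmr (Or.inl heē)
  linarith

/-- **The F-rider family bound (U1-PROOF §6, W-F).**  Units `(S, X)`: hub `X = u.2 ∈ S` a chord avoiding `r`, forest partner
`J = Jof u ∈ S` avoiding `r` and F-rider `ρ = rof u ∈ S` avoiding `r`, `ρ ≠ J`, both meeting `X` at the port `eof u`.
Then `Σ_{u∈U} W(S_u) ≤ (6/32) Σ_{T ∈ U.image {X,J,ρ}} C_T`. -/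
theorem familyRiderF_bound (P P' : ι → V) (hPP' : ∀ X, P X ≠ P' X)
    (hinj : Function.Injective fun X => (s(P X, P' X) : Sym2 V)) (r : V) (F : Finset ι)
    (θ : ι → ℝ) (hθ0 : ∀ X, 0 ≤ θ X) (hθ1 : ∀ X, θ X ≤ 1) (O : ι → V → ℝ) (hO0 : ∀ X d, 0 ≤ O X d) (Φ : ι → ℝ)
    (hO1 : ∀ X d, (P X = d ∨ P' X = d) → θ X ≤ (1 - θ X) * O X d)
    (hO2 : ∀ X, Φ X ^ 2 ≤ O X (P X) * O X (P' X)) (hΦ4 : ∀ X, 4 * θ X ≤ Φ X)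
    (U : Finset (Finset ι × ι)) (Jof rof : Finset ι × ι → ι) (eof : Finset ι × ι → V)
    (hU : ∀ u ∈ U, u.2 ∈ u.1 ∧ u.2 ∉ F ∧ (P u.2 ≠ r ∧ P' u.2 ≠ r) ∧ (P u.2 = eof u ∨ P' u.2 = eof u) ∧
      Jof u ∈ u.1 ∧ Jof u ∈ F ∧ (P (Jof u) ≠ r ∧ P' (Jof u) ≠ r) ∧ (P (Jof u) = eof u ∨ P' (Jof u) = eof u) ∧
      rof u ∈ u.1 ∧ rof u ∈ F ∧ (P (rof u) ≠ r ∧ P' (rof u) ≠ r) ∧ (P (rof u) = eof u ∨ P' (rof u) = eof u) ∧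
      rof u ≠ Jof u) :
    ∑ u ∈ U, ((∏ k ∈ u.1, θ k) * ∏ k ∈ univ \ u.1, (1 - θ k)) ≤
      (6 / 32) * ∑ T ∈ U.image (fun u => ({u.2, Jof u, rof u} : Finset ι)),
        ∑ δ ∈ (univ : Finset (ι → Bool)).filter (fun δ => (∀ K ∉ T, δ K = false) ∧
            3 ≤ (T.image fun K => if δ K then P K else P' K).card ∧ r ∉ T.image fun K => if δ K then P K else P' K),
          ∏ K ∈ T, O K (if δ K then P K else P' K) := by
  -- other ports and distinctness
  have hdata : ∀ u ∈ U, u.2 ≠ Jof u ∧ u.2 ≠ rof u ∧ ∃ ē s s' : V,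
      (P u.2 = ē ∨ P' u.2 = ē) ∧ (P (Jof u) = s ∨ P' (Jof u) = s) ∧ (P (rof u) = s' ∨ P' (rof u) = s') ∧
      eof u ≠ ē ∧ eof u ≠ s ∧ eof u ≠ s' ∧ ē ≠ s ∧ s ≠ s' ∧ eof u ≠ r ∧ ē ≠ r ∧ s ≠ r ∧ s' ≠ r := by
    intro u hu
    obtain ⟨-, hXF, hXr, heX, -, hJF, hJr, heJ, -, hρF, hρr, heρ, hρJ⟩ := hU u hu
    have hXJ : u.2 ≠ Jof u := fun h => hXF (h ▸ hJF)
    have hXρ : u.2 ≠ rof u := fun h => hXF (h ▸ hρF)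
    obtain ⟨ē, hēX, heē⟩ : ∃ ē, (P u.2 = ē ∨ P' u.2 = ē) ∧ eof u ≠ ē := by
      rcases heX with h | h
      · exact ⟨P' u.2, Or.inr rfl, fun h' => hPP' u.2 (h.trans h')⟩
      · exact ⟨P u.2, Or.inl rfl, fun h' => hPP' u.2 (h'.symm.trans h.symm)⟩
    obtain ⟨s, hsJ, hes⟩ : ∃ s, (P (Jof u) = s ∨ P' (Jof u) = s) ∧ eof u ≠ s := by
      rcases heJ with h | h
      · exact ⟨P' (Jof u), Or.inr rfl, fun h' => hPP' (Jof u) (h.trans h')⟩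
      · exact ⟨P (Jof u), Or.inl rfl, fun h' => hPP' (Jof u) (h'.symm.trans h.symm)⟩
    obtain ⟨s', hs'ρ, hes'⟩ : ∃ s', (P (rof u) = s' ∨ P' (rof u) = s') ∧ eof u ≠ s' := by
      rcases heρ with h | h
      · exact ⟨P' (rof u), Or.inr rfl, fun h' => hPP' (rof u) (h.trans h')⟩
      · exact ⟨P (rof u), Or.inl rfl, fun h' => hPP' (rof u) (h'.symm.trans h.symm)⟩
    have hēs : ē ≠ s := by
      intro h; apply hXJ; apply hinj; simp only
      rw [sym2_eq_of_mem_of_mem heē heX hēX, sym2_eq_of_mem_of_mem hes heJ hsJ, h]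
    have hss' : s ≠ s' := by
      intro h; apply hρJ; apply hinj; simp only
      rw [sym2_eq_of_mem_of_mem hes' heρ hs'ρ, sym2_eq_of_mem_of_mem hes heJ hsJ, h]
    have hport_r : ∀ (K : ι) (x : V), (P K ≠ r ∧ P' K ≠ r) → (P K = x ∨ P' K = x) → x ≠ r := by
      rintro K x hK (h | h)
      · rw [← h]; exact hK.1
      · rw [← h]; exact hK.2
    exact ⟨hXJ, hXρ, ē, s, s', hēX, hsJ, hs'ρ, heē, hes, hes', hēs, hss', hport_r _ _ hXr heX, hport_r _ _ hXr hēX,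
      hport_r _ _ hJr hsJ, hport_r _ _ hρr hs'ρ⟩
  refine family_load_le θ hθ0 hθ1 U (fun u => ({u.2, Jof u, rof u} : Finset ι)) (fun u => (u.2, Jof u))
    (fun u => ({u.2, Jof u, rof u} : Finset ι))
    (fun T => ∑ δ ∈ (univ : Finset (ι → Bool)).filter (fun δ => (∀ K ∉ T, δ K = false) ∧
        3 ≤ (T.image fun K => if δ K then P K else P' K).card ∧ r ∉ T.image fun K => if δ K then P K else P' K),
      ∏ K ∈ T, O K (if δ K then P K else P' K))
    (fun u _ => sum_nonneg fun δ _ => prod_nonneg fun K _ => hO0 _ _) 6 32 (by norm_num)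
    (fun u hu => ?_) (fun u _ v _ hres hk => ?_) (fun u _ v _ _ hk huv => ?_) (fun u hu => ?_) (fun w hw => ?_) |>.trans
    (le_of_eq (by ring))
  · obtain ⟨hXS, -, -, -, hJS, -, -, -, hρS, -⟩ := hU u hu
    intro k hk
    rcases mem_insert.1 hk with rfl | hk
    · exact hXS
    rcases mem_insert.1 hk with rfl | hk
    · exact hJS
    · rw [mem_singleton.1 hk]; exact hρS
  · exact hres
  · exact Prod.ext huv (congrArg Prod.fst hk :)
  · obtain ⟨hXJ, hXρ, ē, s, s', hēX, hsJ, hs'ρ, heē, hes, hes', hēs, hss', her, hēr, hsr, hs'r⟩ := hdata u hu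
    obtain ⟨-, -, -, heX, -, -, -, -, -, -, -, heρ, hρJ⟩ := hU u hu
    have hXnot : u.2 ∉ ({Jof u, rof u} : Finset ι) := by simp [hXJ, hXρ]
    rw [prod_insert hXnot, prod_pair (Ne.symm hρJ), ← mul_assoc, le_div_iff₀ (by norm_num : (0 : ℝ) < 32), mul_comm]
    exact riderF_triple_le_cap P P' r θ hθ0 O hO0 Φ hO1 hO2 hΦ4 hXJ hXρ (Ne.symm hρJ) heX hēX hsJ heρ hs'ρ heē hes hes' hēs hss'
      her hēr hsr hs'r
  · obtain ⟨u₀, hu₀, rfl⟩ := mem_image.1 hw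
    obtain ⟨hXJ, hXρ, -⟩ := hdata u₀ hu₀
    obtain ⟨-, -, -, -, -, -, -, -, -, -, -, -, hρJ⟩ := hU u₀ hu₀
    refine rider_keys_card_le_six U _ _ _ ?_ (fun u hu huw => ?_)
    · rw [card_insert_of_notMem (by simp [hXJ, hXρ]), card_pair (Ne.symm hρJ)]
    · obtain ⟨hXJ', -, -⟩ := hdata u hu
      refine ⟨?_, ?_, hXJ'⟩
      · rw [← huw]; exact mem_insert_self _ _
      · rw [← huw]; exact mem_insert_of_mem (mem_insert_self _ _)

/-- **The far-rider family bound (U1-PROOF §6, riders at `ē`).**  Units `(S, X)`: hub `X = u.2 ∈ S` a chord avoiding `r`, forest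
partner `J = Jof u ∈ S` avoiding `r` meeting `X` at `eof u`, and a rider `ρ = rof u ∈ S` avoiding `r`, `ρ ∉ {X, J}`, adjacent to `X` but
not through `eof u`.  Then `Σ_{u∈U} W(S_u) ≤ (6/128) Σ_{T ∈ U.image {X,J,ρ}} C_T`. -/
theorem familyRiderFar_bound (P P' : ι → V) (hPP' : ∀ X, P X ≠ P' X)
    (hinj : Function.Injective fun X => (s(P X, P' X) : Sym2 V)) (r : V) (F : Finset ι)
    (θ : ι → ℝ) (hθ0 : ∀ X, 0 ≤ θ X) (hθ1 : ∀ X, θ X ≤ 1) (O : ι → V → ℝ) (hO0 : ∀ X d, 0 ≤ O X d) (Φ : ι → ℝ)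
    (hO2 : ∀ X, Φ X ^ 2 ≤ O X (P X) * O X (P' X)) (hΦ4 : ∀ X, 4 * θ X ≤ Φ X)
    (U : Finset (Finset ι × ι)) (Jof rof : Finset ι × ι → ι) (eof : Finset ι × ι → V)
    (hU : ∀ u ∈ U, u.2 ∈ u.1 ∧ u.2 ∉ F ∧ (P u.2 ≠ r ∧ P' u.2 ≠ r) ∧ (P u.2 = eof u ∨ P' u.2 = eof u) ∧
      Jof u ∈ u.1 ∧ Jof u ∈ F ∧ (P (Jof u) ≠ r ∧ P' (Jof u) ≠ r) ∧ (P (Jof u) = eof u ∨ P' (Jof u) = eof u) ∧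
      rof u ∈ u.1 ∧ rof u ≠ u.2 ∧ rof u ≠ Jof u ∧ (P (rof u) ≠ r ∧ P' (rof u) ≠ r) ∧
      ¬ (P (rof u) = eof u ∨ P' (rof u) = eof u) ∧
      (P (rof u) = P u.2 ∨ P (rof u) = P' u.2 ∨ P' (rof u) = P u.2 ∨ P' (rof u) = P' u.2)) :
    ∑ u ∈ U, ((∏ k ∈ u.1, θ k) * ∏ k ∈ univ \ u.1, (1 - θ k)) ≤
      (6 / 128) * ∑ T ∈ U.image (fun u => ({u.2, Jof u, rof u} : Finset ι)),
        ∑ δ ∈ (univ : Finset (ι → Bool)).filter (fun δ => (∀ K ∉ T, δ K = false) ∧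
            3 ≤ (T.image fun K => if δ K then P K else P' K).card ∧ r ∉ T.image fun K => if δ K then P K else P' K),
          ∏ K ∈ T, O K (if δ K then P K else P' K) := by
  have hdata : ∀ u ∈ U, u.2 ≠ Jof u ∧ ∃ ē s m : V,
      (P u.2 = ē ∨ P' u.2 = ē) ∧ (P (Jof u) = s ∨ P' (Jof u) = s) ∧ (P (rof u) = ē ∨ P' (rof u) = ē) ∧
      (P (rof u) = m ∨ P' (rof u) = m) ∧
      eof u ≠ ē ∧ eof u ≠ s ∧ eof u ≠ m ∧ ē ≠ s ∧ ē ≠ m ∧ eof u ≠ r ∧ ē ≠ r ∧ s ≠ r ∧ m ≠ r := by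
    intro u hu
    obtain ⟨-, hXF, hXr, heX, -, hJF, hJr, heJ, -, hρX, hρJ, hρr, hρe, hρadj⟩ := hU u hu
    have hXJ : u.2 ≠ Jof u := fun h => hXF (h ▸ hJF)
    obtain ⟨ē, hēX, heē⟩ : ∃ ē, (P u.2 = ē ∨ P' u.2 = ē) ∧ eof u ≠ ē := by
      rcases heX with h | h
      · exact ⟨P' u.2, Or.inr rfl, fun h' => hPP' u.2 (h.trans h')⟩
      · exact ⟨P u.2, Or.inl rfl, fun h' => hPP' u.2 (h'.symm.trans h.symm)⟩
    obtain ⟨s, hsJ, hes⟩ : ∃ s, (P (Jof u) = s ∨ P' (Jof u) = s) ∧ eof u ≠ s := by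
      rcases heJ with h | h
      · exact ⟨P' (Jof u), Or.inr rfl, fun h' => hPP' (Jof u) (h.trans h')⟩
      · exact ⟨P (Jof u), Or.inl rfl, fun h' => hPP' (Jof u) (h'.symm.trans h.symm)⟩
    -- `ρ` passes through `ē`
    have hēρ : P (rof u) = ē ∨ P' (rof u) = ē := by
      have hρe' : P (rof u) ≠ eof u ∧ P' (rof u) ≠ eof u := ⟨fun h => hρe (Or.inl h), fun h => hρe (Or.inr h)⟩
      rcases heX with hXe | hXe <;> rcases hēX with hXē | hXē
      · exact absurd (hXe.symm.trans hXē) heē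
      · rcases hρadj with h | h | h | h
        · exact absurd (h.trans hXe) hρe'.1
        · exact Or.inl (h.trans hXē)
        · exact absurd (h.trans hXe) hρe'.2
        · exact Or.inr (h.trans hXē)
      · rcases hρadj with h | h | h | h
        · exact Or.inl (h.trans hXē)
        · exact absurd (h.trans hXe) hρe'.1
        · exact Or.inr (h.trans hXē)
        · exact absurd (h.trans hXe) hρe'.2
      · exact absurd (hXe.symm.trans hXē) heē
    obtain ⟨m, hmρ, hēm⟩ : ∃ m, (P (rof u) = m ∨ P' (rof u) = m) ∧ ē ≠ m := by
      rcases hēρ with h | h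
      · exact ⟨P' (rof u), Or.inr rfl, fun h' => hPP' (rof u) (h.trans h')⟩
      · exact ⟨P (rof u), Or.inl rfl, fun h' => hPP' (rof u) (h'.symm.trans h.symm)⟩
    have hēs : ē ≠ s := by
      intro h; apply hXJ; apply hinj; simp only
      rw [sym2_eq_of_mem_of_mem heē heX hēX, sym2_eq_of_mem_of_mem hes heJ hsJ, h]
    have hem : eof u ≠ m := by
      intro h; apply hρX; apply hinj; simp only
      rw [sym2_eq_of_mem_of_mem hēm hēρ hmρ, sym2_eq_of_mem_of_mem heē.symm hēX heX, h]
    have hport_r : ∀ (K : ι) (x : V), (P K ≠ r ∧ P' K ≠ r) → (P K = x ∨ P' K = x) → x ≠ r := by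
      rintro K x hK (h | h)
      · rw [← h]; exact hK.1
      · rw [← h]; exact hK.2
    exact ⟨hXJ, ē, s, m, hēX, hsJ, hēρ, hmρ, heē, hes, hem, hēs, hēm, hport_r _ _ hXr heX, hport_r _ _ hXr hēX,
      hport_r _ _ hJr hsJ, hport_r _ _ hρr hmρ⟩
  refine family_load_le θ hθ0 hθ1 U (fun u => ({u.2, Jof u, rof u} : Finset ι)) (fun u => (u.2, Jof u))
    (fun u => ({u.2, Jof u, rof u} : Finset ι))
    (fun T => ∑ δ ∈ (univ : Finset (ι → Bool)).filter (fun δ => (∀ K ∉ T, δ K = false) ∧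
        3 ≤ (T.image fun K => if δ K then P K else P' K).card ∧ r ∉ T.image fun K => if δ K then P K else P' K),
      ∏ K ∈ T, O K (if δ K then P K else P' K))
    (fun u _ => sum_nonneg fun δ _ => prod_nonneg fun K _ => hO0 _ _) 6 128 (by norm_num)
    (fun u hu => ?_) (fun u _ v _ hres hk => ?_) (fun u _ v _ _ hk huv => ?_) (fun u hu => ?_) (fun w hw => ?_) |>.trans
    (le_of_eq (by ring))
  · obtain ⟨hXS, -, -, -, hJS, -, -, -, hρS, -⟩ := hU u hu
    intro k hk
    rcases mem_insert.1 hk with rfl | hk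
    · exact hXS
    rcases mem_insert.1 hk with rfl | hk
    · exact hJS
    · rw [mem_singleton.1 hk]; exact hρS
  · exact hres
  · exact Prod.ext huv (congrArg Prod.fst hk :)
  · obtain ⟨hXJ, ē, s, m, hēX, hsJ, hēρ, hmρ, heē, hes, hem, hēs, hēm, her, hēr, hsr, hmr⟩ := hdata u hu
    obtain ⟨-, -, -, heX, -, -, -, heJ, -, hρX, hρJ, -⟩ := hU u hu
    have hXnot : u.2 ∉ ({Jof u, rof u} : Finset ι) := by simp [hXJ, Ne.symm hρX]
    rw [prod_insert hXnot, prod_pair (Ne.symm hρJ), ← mul_assoc, le_div_iff₀ (by norm_num : (0 : ℝ) < 128), mul_comm]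
    exact riderFar_triple_le_cap P P' r θ hθ0 O hO0 Φ hO2 hΦ4 hXJ (Ne.symm hρX) (Ne.symm hρJ) heX hēX heJ hsJ hēρ hmρ
      heē hes hem hēs hēm her hēr hsr hmr
  · obtain ⟨u₀, hu₀, rfl⟩ := mem_image.1 hw
    obtain ⟨hXJ, -⟩ := hdata u₀ hu₀
    obtain ⟨-, -, -, -, -, -, -, -, -, hρX, hρJ, -⟩ := hU u₀ hu₀
    refine rider_keys_card_le_six U _ _ _ ?_ (fun u hu huw => ?_)
    · rw [card_insert_of_notMem (by simp [hXJ, Ne.symm hρX]), card_pair (Ne.symm hρJ)]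
    · obtain ⟨hXJ', -⟩ := hdata u hu
      refine ⟨?_, ?_, hXJ'⟩
      · rw [← huw]; exact mem_insert_self _ _
      · rw [← huw]; exact mem_insert_of_mem (mem_insert_self _ _)

end StarSet

end Summit.CriticalPhenomena.PercolationContinuityZ3.Theorems
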